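import Summits.HodgeConjecture.HodgeConjecture.Theorems.EquidimSocketThickLinkedLiftOpen
import Summits.HodgeConjecture.HodgeConjecture.Theorems.EquidimThickTransfer
import Literature.AlgebraicGeometry.ModuliOfAbelianVarieties.SiegelHeckeLinkDegree
import HarnessLib

/-!
# E-road: NO THIN PIECE of the Siegel moduli scheme, modulo the isogeny-quotient maps — socket (B) text v8

Cell hodgecm-mathlib (D-0151), E-road «EQUIDIM by proof» (skeleton `Cruxes/HDel/Lines/EquidimOfF.lean`, residual `stub_noThinPiece`),
B-plan1 (g15) 2026-08-29T23:17:31Z/23:19:57Z/23:33:35Z SOCKET (B) TEXT v8 (`B-plan/F-census/SOCKET-B-v8.text.B-plan1g15.lean`): ed.3 of ★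
`Theorems/EquidimNoThinPiece` with the three v8 deltas in the hypothesis `hQuot₃` — (1) the upstairs piece `ι′ : S″ ⟶ 𝓜′_ℂ` is an OPEN
IMMERSION (`[IsOpenImmersion ι'.left]`, so that `S″` is separated, locally Noetherian, quasi-projective: the socket-(B) assembler's quotient
road needs it), and (2) the link carries its DEGREE: `HeckeLinkedDeg 𝓜 𝓜′ r′ (ι′ s′) x (N′/N)` (★ `SiegelHeckeLinkDegree`, B-p14 (g14))
followed by `Odd (N′/N)` and (3) `Nat.Coprime (N′/N) (∏ i, δ i)` (the isogeny degree is prime to the type).  The producer is socket (A) in its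
OPEN-DEGREE form ★ `EquidimSocketThickLinkedLiftOpen.thickLinkedLift_heckeLinkedDeg_odd_open`
(B-p18 (g17)), which exports the open immersion, the similitude factor and its parity/coprimality (a prime `ℓ > N ∏ δᵢ`); the transfer (T2) is ★
`EquidimThickTransfer.isThickAt_of_periodCompatible_of_continuous`; THICK ⇒ `g(g+1)/2 ≤ d` is ★ `EquidimThickIffLe`.  THEOREMS ONLY,
`--supports stmt-HodgeConjecture-24835` (count-neutral helper).  HC_CM is proved only modulo the 7 printed citations until rung 0 closes.

* `stubThick_of_quotientMaps₃ (hF) (hQuot₃) … (t) : IsThickAt hδ 𝓜 ι d t`;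
* `noThinPiece_of_quotientMaps₃ (hF) (hQuot₃) … (q) (hq) : g(g+1)/2 ≤ d` — the text of `NoThinPiece`, modulo `hQuot₃` (= v8) alone;
  the E-road v1.4 writes `stub_noThinPiece` over it.

## References
* [LangeBirkenhake1992] H. Lange, Ch. Birkenhake, *Complex Abelian Varieties* (1992), Ch. 8 §8.1.
* [MumfordFogartyKirwan1994] GIT 3rd ed., Ch. 7 §3 Thm. 7.9 (p. 139), App. 7A (p. 235).
* [Milne2005ShimuraVarieties] J. S. Milne, *Introduction to Shimura varieties* (2005), §6 Thm. 6.11 (pp. 74–75).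
-/

set_option autoImplicit false
set_option linter.dupNamespace false  -- `Summit.HodgeConjecture.HodgeConjecture.…` is the cell's layout (D-0017)

noncomputable section

open CategoryTheory CategoryTheory.Limits AlgebraicGeometry Matrix Topology
open Literature.AlgebraicGeometry
open Literature.AlgebraicGeometry.Motives (SchemeOver ComplexPoints AlgPoints specOver)
open Literature.AlgebraicGeometry.AbelianSchemes (PolarizedAbelianSchemeWithLevel)
open Literature.AlgebraicGeometry.ModuliOfAbelianVarieties
open Literature.AlgebraicGeometry.ModuliOfAbelianVarieties.EquidimOfF
open Literature.NumberTheory.Automorphic (siegelUpperHalfSpace)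
open Literature.NumberTheory.Adeles

namespace Summit.HodgeConjecture.HodgeConjecture.Theorems

namespace EquidimNoThinPieceOpen

open SiegelModuli

variable {g : ℕ}

/-- **(socket (B) text v8) EVERY COMPLEX POINT OF EVERY SMOOTH OPEN PIECE OF `𝓜_ℂ` IS THICK, modulo the isogeny-quotient maps
of open, degree-carrying Hecke links at odd relative level prime to the type** (`hQuot₃` = `SocketQuotientMaps₈` token-for-token): at `t`,
★ socket (A) (open-degree form) gives `(𝓜′, ι′ open, r′, s′)` upstairs with `s′` thick w.r.t. `r′`, `ι′ s′` Hecke-linked to `ι t` with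
degree `N′/N` odd and prime to `∏ δᵢ`; `hQuot₃` gives the period-compatible continuous `Φ` with `Φ s′ = ι t`; ★ (T2) transfers thickness.
[cite: LangeBirkenhake1992, Ch. 8 §8.1] [cite: Milne2005ShimuraVarieties, §6 Thm. 6.11 pp. 74–75] -/
theorem stubThick_of_quotientMaps₃ (hF : lan2013_siegelFineModuliScheme)
    (hQuot₃ : ∀ (_hF : lan2013_siegelFineModuliScheme) (g N N' : ℕ) (δ δ' : Fin g → ℕ) (_hg : 0 < g)
      (hδ : IsPolarizationType δ) (_hN : 3 ≤ N) (hδ' : IsPolarizationType δ')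
      (𝓜 : SiegelFineModuliScheme g N δ) (𝓜' : SiegelFineModuliScheme g N' δ')
      (S'' : SchemeOver ℂ) (ι' : S'' ⟶ (Motives.baseChange ℚ ℂ).obj 𝓜'.M) [IsOpenImmersion ι'.left]
      (d'' : ℕ) [SmoothOfRelativeDimension d'' S''.hom] (r' : gspFinAdelic δ') (_ : r' ∈ principalLevelSubgroup δ' 1)
      (s' : ComplexPoints S'') (_ : IsThickAtWith hδ' 𝓜' ι' d'' s' r')
      (x : ComplexPoints ((Motives.baseChange ℚ ℂ).obj 𝓜.M)),
      HeckeLinkedDeg 𝓜 𝓜' r' (AlgPoints.map (L := ℂ) ι' s') x (N' / N) → Odd (N' / N) →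
      Nat.Coprime (N' / N) (∏ i, δ i) →
      haveI : IsLocallyNoetherian (specOver ℚ ℂ).left := inferInstanceAs (IsLocallyNoetherian (Spec (CommRingCat.of ℂ)))
      ∃ (Φ : ComplexPoints S'' → ComplexPoints ((Motives.baseChange ℚ ℂ).obj 𝓜.M)) (_ : Continuous Φ) (_ : Φ s' = x)
        (θ : siegelUpperHalfSpace g → siegelUpperHalfSpace g) (_ : IsOpenMap θ)
        (r : gspFinAdelic δ) (_ : r ∈ principalLevelSubgroup δ 1),
        ∀ (s : ComplexPoints S'') (Z : siegelUpperHalfSpace g)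
          (P' : PolarizedAbelianSchemeWithLevel g N' δ' (specOver ℚ ℂ).left),
          IsAdmissibleAt hδ' r' Z.1 Z.2 P' →
          AlgPoints.baseChangeEquiv (algebraMap ℚ ℂ) 𝓜'.M (𝓜'.classifyingMap (specOver ℚ ℂ) P') =
            AlgPoints.map (L := ℂ) ι' s →
          ∃ P : PolarizedAbelianSchemeWithLevel g N δ (specOver ℚ ℂ).left,
            IsAdmissibleAt hδ r (θ Z).1 (θ Z).2 P ∧
            AlgPoints.baseChangeEquiv (algebraMap ℚ ℂ) 𝓜.M (𝓜.classifyingMap (specOver ℚ ℂ) P) = Φ s)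
    (N : ℕ) (δ : Fin g → ℕ) (hg : 0 < g) (hδ : IsPolarizationType δ) (hN : 3 ≤ N) (𝓜 : SiegelFineModuliScheme g N δ)
    {S' : SchemeOver ℂ} (ι : S' ⟶ (Motives.baseChange ℚ ℂ).obj 𝓜.M) [IsOpenImmersion ι.left]
    (d : ℕ) [SmoothOfRelativeDimension d S'.hom] (t : ComplexPoints S') : IsThickAt hδ 𝓜 ι d t := by
  obtain ⟨N', δ', hδ', 𝓜', S'', ι', hι', d'', hd'', r', hr', s', hthick, hlink, hodd, hcop⟩ :=
    EquidimSocketThickLinkedLiftOpen.thickLinkedLift_heckeLinkedDeg_odd_open hF g N δ hg hδ hN 𝓜 (AlgPoints.map (L := ℂ) ι t)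
  haveI := hι'
  haveI := hd''
  obtain ⟨Φ, hΦ, hΦs, θ, hθo, r, hr, hcompat⟩ :=
    hQuot₃ hF g N N' δ δ' hg hδ hN hδ' 𝓜 𝓜' S'' ι' d'' r' hr' s' hthick _ hlink hodd hcop
  exact EquidimThickTransfer.isThickAt_of_periodCompatible_of_continuous hF hg hδ hN hδ' 𝓜 𝓜' ι' d'' s' r' hthick Φ hΦ θ hθo
    r hr hcompat ι d t hΦs.symm

/-- **(socket (B) text v8) NO THIN PIECE, modulo the isogeny-quotient maps of open, degree-carrying Hecke links at odd relative
level prime to the type** — the text of the E-road residual `NoThinPiece`: every smooth open piece `ι : S′ ⟶ 𝓜_ℂ` of relative dimension `d` with a `ℂ`-point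
has `g(g+1)/2 ≤ d` (★ `EquidimThickIffLe.stub_ge'_of_thick` over `stubThick_of_quotientMaps₃`); the E-road v1.4 writes
`stub_noThinPiece := noThinPiece_of_quotientMaps₃ hF stub_quotientMaps₈ …`. [cite: LangeBirkenhake1992, Ch. 8 §8.1]
[cite: MumfordFogartyKirwan1994, App. 7A (p. 235)] -/
theorem noThinPiece_of_quotientMaps₃ (hF : lan2013_siegelFineModuliScheme)
    (hQuot₃ : ∀ (_hF : lan2013_siegelFineModuliScheme) (g N N' : ℕ) (δ δ' : Fin g → ℕ) (_hg : 0 < g)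
      (hδ : IsPolarizationType δ) (_hN : 3 ≤ N) (hδ' : IsPolarizationType δ')
      (𝓜 : SiegelFineModuliScheme g N δ) (𝓜' : SiegelFineModuliScheme g N' δ')
      (S'' : SchemeOver ℂ) (ι' : S'' ⟶ (Motives.baseChange ℚ ℂ).obj 𝓜'.M) [IsOpenImmersion ι'.left]
      (d'' : ℕ) [SmoothOfRelativeDimension d'' S''.hom] (r' : gspFinAdelic δ') (_ : r' ∈ principalLevelSubgroup δ' 1)
      (s' : ComplexPoints S'') (_ : IsThickAtWith hδ' 𝓜' ι' d'' s' r')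
      (x : ComplexPoints ((Motives.baseChange ℚ ℂ).obj 𝓜.M)),
      HeckeLinkedDeg 𝓜 𝓜' r' (AlgPoints.map (L := ℂ) ι' s') x (N' / N) → Odd (N' / N) →
      Nat.Coprime (N' / N) (∏ i, δ i) →
      haveI : IsLocallyNoetherian (specOver ℚ ℂ).left := inferInstanceAs (IsLocallyNoetherian (Spec (CommRingCat.of ℂ)))
      ∃ (Φ : ComplexPoints S'' → ComplexPoints ((Motives.baseChange ℚ ℂ).obj 𝓜.M)) (_ : Continuous Φ) (_ : Φ s' = x)
        (θ : siegelUpperHalfSpace g → siegelUpperHalfSpace g) (_ : IsOpenMap θ)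
        (r : gspFinAdelic δ) (_ : r ∈ principalLevelSubgroup δ 1),
        ∀ (s : ComplexPoints S'') (Z : siegelUpperHalfSpace g)
          (P' : PolarizedAbelianSchemeWithLevel g N' δ' (specOver ℚ ℂ).left),
          IsAdmissibleAt hδ' r' Z.1 Z.2 P' →
          AlgPoints.baseChangeEquiv (algebraMap ℚ ℂ) 𝓜'.M (𝓜'.classifyingMap (specOver ℚ ℂ) P') =
            AlgPoints.map (L := ℂ) ι' s →
          ∃ P : PolarizedAbelianSchemeWithLevel g N δ (specOver ℚ ℂ).left,
            IsAdmissibleAt hδ r (θ Z).1 (θ Z).2 P ∧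
            AlgPoints.baseChangeEquiv (algebraMap ℚ ℂ) 𝓜.M (𝓜.classifyingMap (specOver ℚ ℂ) P) = Φ s)
    (N : ℕ) (δ : Fin g → ℕ) (hg : 0 < g) (hδ : IsPolarizationType δ) (hN : 3 ≤ N) (𝓜 : SiegelFineModuliScheme g N δ)
    (S' : SchemeOver ℂ) (ι : S' ⟶ (Motives.baseChange ℚ ℂ).obj 𝓜.M) [IsOpenImmersion ι.left]
    (d : ℕ) [SmoothOfRelativeDimension d S'.hom]
    (q : Spec (CommRingCat.of ℂ) ⟶ S'.left) (hq : q ≫ S'.hom = 𝟙 _) : g * (g + 1) / 2 ≤ d :=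
  EquidimThickIffLe.stub_ge'_of_thick hδ 𝓜
    (fun _ ι' _ d' _ t ↦ stubThick_of_quotientMaps₃ hF hQuot₃ N δ hg hδ hN 𝓜 ι' d' t) S' ι d q hq

end EquidimNoThinPieceOpen

end Summit.HodgeConjecture.HodgeConjecture.Theorems

end
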